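import Mathlib

/-!
# Solo (blind) rung s16c: the algebra behind THEOREM S₃′ — isotropic reduction of the cone cells

Soloist report `sharpest.md` v16b §2.8 (S′), claims C51–C55: *the energy is the only polynomial
first-order Lyapunov density of degree ≤ 3 of Navier–Stokes*. The analytic theorem is proved in the
report (exact-arithmetic Null/Rank Lemmas, LEMMA B, LEMMA N, LEMMA T); this file kernel-checks the
finite-dimensional skeleton that carries it:

* `sIII_cascade_deg3`: the degree-3 case of the (S-iii) cascade — if `ε (N₂₁ + ε N₁₂ + ε² N₀₃) ≤ 0`
  for `ε > 0` and `≥ 0` for `ε < 0` (what the two-parameter scaling and the parity/sign symmetries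
  leave of hypothesis (L) in top degree 3), then `N₂₁ ≤ 0`, `N₀₃ ≤ 0` and `N₁₂² ≤ 4 N₂₁ N₀₃`;
  `sIII_middle_vanishes`: once the first cone cell is closed (`N₂₁ = 0`) the middle rate vanishes.
* `ConvexCone.neg_mem_of_pos_smul_add_eq_zero`, `ConvexCone.eq_zero_of_salient_of_pos_smul_add_eq_zero`:
  the finite form of LEMMA B (isotropic reduction): in a salient convex cone, an element admitting a
  positive combination with other cone elements summing to zero is zero — applied in the report to
  the orbit of a density under rotations, whose Haar barycentre is isotropic.
* `trace_sq_mul_transpose_sub_trace_cube`: for every real 3×3 matrix `A` with symmetric part `S` and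
  axial vector `ω` of `A − Aᵀ`, `tr(A A Aᵀ) − tr(A³) = (tr A)|ω|² − ωᵀ S ω`; with
  `trace_cube_eq_three_mul_det_of_trace_zero` (`tr A³ = 3 det A` for traceless `A`, and `det ∇u` is a
  null Lagrangian) this is why the isotropic part of the cubic cell (0,3) is the single class `[ωᵀSω]`,
  which LEMMA N kills; `quadForm_eq_quadForm_symm` is the algebraic half of `uᵀ(∇u)u = ½ div(|u|²u)`,
  why the isotropic part of cell (2,1) is null.
Everything is finite-dimensional real algebra; no analysis is formalised.
-/

set_option linter.dupNamespace false

namespace Summit.NavierStokesRegularity.NavierStokesRegularity.Theorems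

open Matrix

/-- Degree-3 case of the (S-iii) cascade. If `ε·Q(ε) ≤ 0` for all `ε > 0` and `ε·Q(ε) ≥ 0` for all
`ε < 0`, where `Q(ε) = N₂₁ + ε N₁₂ + ε² N₀₃`, then `Q ≤ 0` on `ℝ ∖ {0}`, hence (quadratic in `ε`)
`N₂₁ ≤ 0`, `N₀₃ ≤ 0` and the discriminant bound `N₁₂² ≤ 4 N₂₁ N₀₃`. -/
theorem sIII_cascade_deg3 (N21 N12 N03 : ℝ)
    (hpos : ∀ ε : ℝ, 0 < ε → ε * (N21 + ε * N12 + ε ^ 2 * N03) ≤ 0)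
    (hneg : ∀ ε : ℝ, ε < 0 → 0 ≤ ε * (N21 + ε * N12 + ε ^ 2 * N03)) :
    N21 ≤ 0 ∧ N03 ≤ 0 ∧ N12 ^ 2 ≤ 4 * N21 * N03 := by
  -- Q ≤ 0 away from 0
  have hQ : ∀ ε : ℝ, ε ≠ 0 → N21 + ε * N12 + ε ^ 2 * N03 ≤ 0 := by
    intro ε hε
    rcases lt_or_gt_of_ne hε with h | h
    · have := hneg ε h
      -- ε < 0 and ε * Q ≥ 0 ⟹ Q ≤ 0
      by_contra hc
      have hc' := not_le.mp hc
      have : ε * (N21 + ε * N12 + ε ^ 2 * N03) < 0 := mul_neg_of_neg_of_pos h hc'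
      linarith
    · have := hpos ε h
      by_contra hc
      have hc' := not_le.mp hc
      have : 0 < ε * (N21 + ε * N12 + ε ^ 2 * N03) := mul_pos h hc'
      linarith
  -- symmetrised: N21 + δ² N03 ≤ 0 for δ ≠ 0
  have hsym : ∀ δ : ℝ, δ ≠ 0 → N21 + δ ^ 2 * N03 ≤ 0 := by
    intro δ hδ
    have h1 := hQ δ hδ
    have h2 := hQ (-δ) (neg_ne_zero.mpr hδ)
    nlinarith
  -- N21 ≤ 0
  have h21 : N21 ≤ 0 := by
    by_contra hc
    have hc' : 0 < N21 := not_le.mp hc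
    rcases le_or_gt 0 N03 with h03 | h03
    · have := hsym 1 one_ne_zero
      nlinarith
    · -- N03 < 0: take δ² = N21 / (-2 N03)
      set t : ℝ := N21 / (-2 * N03) with ht
      have htpos : 0 < t := by
        rw [ht]; apply div_pos hc'; linarith
      have hδ : Real.sqrt t ≠ 0 := ne_of_gt (Real.sqrt_pos.mpr htpos)
      have := hsym (Real.sqrt t) hδ
      rw [Real.sq_sqrt htpos.le, ht] at this
      have hN03 : N03 ≠ 0 := ne_of_lt h03
      have hkey : N21 / (-2 * N03) * N03 = -(N21 / 2) := by
        field_simp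
      linarith
  -- N03 ≤ 0
  have h03 : N03 ≤ 0 := by
    by_contra hc
    have hc' : 0 < N03 := not_le.mp hc
    set t : ℝ := (1 - N21) / N03 with ht
    have htpos : 0 < t := by
      rw [ht]; apply div_pos _ hc'; linarith
    have hδ : Real.sqrt t ≠ 0 := ne_of_gt (Real.sqrt_pos.mpr htpos)
    have := hsym (Real.sqrt t) hδ
    rw [Real.sq_sqrt htpos.le, ht] at this
    have hne : N03 ≠ 0 := ne_of_gt hc'
    have hkey : (1 - N21) / N03 * N03 = 1 - N21 := by
      field_simp
    linarith
  refine ⟨h21, h03, ?_⟩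
  -- discriminant: Q(0) ≤ 0 too, then Mathlib's `discrim_le_zero_of_nonpos`
  have hall : ∀ x : ℝ, N03 * (x * x) + N12 * x + N21 ≤ 0 := by
    intro x
    rcases eq_or_ne x 0 with hx | hx
    · subst hx; simpa using h21
    · have := hQ x hx
      nlinarith
  have hd := discrim_le_zero_of_nonpos hall
  unfold discrim at hd
  nlinarith

/-- Once the first cone cell is closed (`N₂₁ = 0` identically), the discriminant bound of
`sIII_cascade_deg3` forces the middle Euler rate to vanish: `N₁₂ = 0`. -/
theorem sIII_middle_vanishes (N21 N12 N03 : ℝ) (h : N12 ^ 2 ≤ 4 * N21 * N03) (h21 : N21 = 0) :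
    N12 = 0 := by
  subst h21
  have : N12 ^ 2 ≤ 0 := by simpa using h
  exact pow_eq_zero_iff (n := 2) (by norm_num) |>.mp (le_antisymm this (sq_nonneg _))

/-- Finite form of LEMMA B (isotropic reduction), first half: in a convex cone, if `c • x + y = 0`
with `c > 0` and `y` in the cone, then `-x` is in the cone. (In the report `y` is a positive
combination of rotated copies of the density `x`, and the vanishing of the sum expresses that the
Haar barycentre of the orbit — an isotropic density — is zero.) -/
theorem ConvexCone.neg_mem_of_pos_smul_add_eq_zero {E : Type*} [AddCommGroup E] [Module ℝ E]
    (K : ConvexCone ℝ E) {x y : E} {c : ℝ} (hc : 0 < c) (hy : y ∈ K) (h : c • x + y = 0) :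
    -x ∈ K := by
  have hyx : y = -(c • x) := eq_neg_of_add_eq_zero_right h
  have : -x = c⁻¹ • y := by
    rw [hyx, smul_neg, ← mul_smul, inv_mul_cancel₀ (ne_of_gt hc), one_smul]
  rw [this]
  exact K.smul_mem (inv_pos.mpr hc) hy

/-- Finite form of LEMMA B, second half: if moreover the cone is SALIENT (`K ∩ −K ⊆ {0}`; in the
report: no non-null density has identically vanishing Euler rate — the Rank Lemma) and `x ∈ K`, then
`x = 0`. Hence a salient invariant cone containing a density whose orbit barycentre vanishes does not
contain that density unless it is zero: the cone cells reduce to their isotropic elements. -/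
theorem ConvexCone.eq_zero_of_salient_of_pos_smul_add_eq_zero {E : Type*} [AddCommGroup E]
    [Module ℝ E] (K : ConvexCone ℝ E) (hK : K.Salient) {x y : E} {c : ℝ} (hc : 0 < c) (hx : x ∈ K)
    (hy : y ∈ K) (h : c • x + y = 0) : x = 0 := by
  by_contra hx0
  exact hK x hx hx0 (ConvexCone.neg_mem_of_pos_smul_add_eq_zero K hc hy h)

/-- The two isotropic cubic invariants of a 3×3 matrix differ by the enstrophy production:
`tr(A A Aᵀ) − tr(A³) = (tr A)·|ω|² − ωᵀ S ω`, where `S = (A + Aᵀ)/2` and `ω` is the axial vector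
of `A − Aᵀ` (for `A = ∇u`: the vorticity). For divergence-free `u` (`tr A = 0`) and modulo the null
density `tr A³ = 3 det ∇u`, the isotropic part of the cubic cell (0,3) is therefore the single class
`[ωᵀSω]`, whose Euler rate LEMMA N shows indefinite. -/
theorem trace_sq_mul_transpose_sub_trace_cube (a00 a01 a02 a10 a11 a12 a20 a21 a22 : ℝ) :
    let A : Matrix (Fin 3) (Fin 3) ℝ := !![a00, a01, a02; a10, a11, a12; a20, a21, a22]
    let S : Matrix (Fin 3) (Fin 3) ℝ :=
      !![a00, (a01 + a10) / 2, (a02 + a20) / 2;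
         (a01 + a10) / 2, a11, (a12 + a21) / 2;
         (a02 + a20) / 2, (a12 + a21) / 2, a22]
    let ω : Fin 3 → ℝ := ![a21 - a12, a02 - a20, a10 - a01]
    Matrix.trace (A * A * Aᵀ) - Matrix.trace (A * A * A)
      = Matrix.trace A * (ω ⬝ᵥ ω) - ω ⬝ᵥ (S *ᵥ ω) := by
  intro A S ω
  have hT : Aᵀ = !![a00, a10, a20; a01, a11, a21; a02, a12, a22] := by
    ext i j
    fin_cases i <;> fin_cases j <;> rfl
  rw [hT]
  simp [A, S, ω, Matrix.trace, Fin.sum_univ_three, Matrix.mulVec, dotProduct]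
  ring

/-- `tr A³ = 3 det A` for a traceless real 3×3 matrix (Cayley–Hamilton); with `A = ∇u`, `det ∇u`
is a null Lagrangian, so `∫ tr(∇u)³ = 0` on divergence-free fields (Betchov) — the algebraic half. -/
theorem trace_cube_eq_three_mul_det_of_trace_zero (a00 a01 a02 a10 a11 a12 a20 a21 a22 : ℝ)
    (htr : a00 + a11 + a22 = 0) :
    let A : Matrix (Fin 3) (Fin 3) ℝ := !![a00, a01, a02; a10, a11, a12; a20, a21, a22]
    Matrix.trace (A * A * A) = 3 * Matrix.det A := by
  intro A
  have h22 : a22 = -(a00 + a11) := by linarith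
  subst h22
  simp [A, Matrix.trace, Fin.sum_univ_three, Matrix.det_fin_three]
  ring

/-- The quadratic form of a matrix only sees its symmetric part: `uᵀ A u = uᵀ S u`. With `A = ∇u`
this is `u·((u·∇)u) = ½ u·∇|u|² = ½ div(|u|² u)` for divergence-free `u` — the unique isotropic
density of cell (2,1) is null (algebraic half). -/
theorem quadForm_eq_quadForm_symm (a00 a01 a02 a10 a11 a12 a20 a21 a22 u0 u1 u2 : ℝ) :
    let A : Matrix (Fin 3) (Fin 3) ℝ := !![a00, a01, a02; a10, a11, a12; a20, a21, a22]
    let S : Matrix (Fin 3) (Fin 3) ℝ :=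
      !![a00, (a01 + a10) / 2, (a02 + a20) / 2;
         (a01 + a10) / 2, a11, (a12 + a21) / 2;
         (a02 + a20) / 2, (a12 + a21) / 2, a22]
    let u : Fin 3 → ℝ := ![u0, u1, u2]
    u ⬝ᵥ (A *ᵥ u) = u ⬝ᵥ (S *ᵥ u) := by
  intro A S u
  simp [A, S, u, Matrix.mulVec, dotProduct, Fin.sum_univ_three]
  ring

end Summit.NavierStokesRegularity.NavierStokesRegularity.Theorems
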